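import Mathlib
import Summits.ValiantsHypothesis.ValiantsHypothesis.Theorems.NewtonTauWeak.Negative.Zonogon
import Summits.ValiantsHypothesis.ValiantsHypothesis.Theorems.NewtonUnitEquationsNewtonTauWeakSeparatedRank
import Summits.ValiantsHypothesis.ValiantsHypothesis.Theorems.NewtonUnitEquationsNewtonTauWeakVdpDefs
import Summits.ValiantsHypothesis.ValiantsHypothesis.Theorems.NewtonUnitEquationsNewtonTauWeakStubVertexCharts
import Summits.ValiantsHypothesis.ValiantsHypothesis.Theorems.NewtonUnitEquationsNewtonTauWeakStubChartPairCount
import Summits.ValiantsHypothesis.ValiantsHypothesis.Theorems.NewtonUnitEquationsNewtonTauWeakStubProductVertices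

/-!
# `NewtonUnitEquationsNewtonTauWeakHexagonPlanar` — Δ-Wronskian rung, HexagonPlanar

Rung toward `stub_binomialNewtonTauCommon` (crux `NewtonTauWeak`, stmt-ValiantsHypothesis-5904), line
`binomial-normal-form`, lead c3: the GLOBAL Δ-WRONSKIAN argument for sums of three hexagon products
`A(x)·B(y)·C(xy)` (exponent lists on the three lines through `(1,0)`, `(0,1)`, `(1,1)`; any degrees).

This file: planar counting — at most two extreme points of a planar hull on a line, hence at most two tops of `f` on an anti-diagonal `e₀ - e₁ = r` (registered stub `hex_ncard_tops_sub_eq_le_two`); the indicator polynomial of a union of supports and the count of its chart tops / vertices by those of the pieces (registered stubs `hex_ncard_chartTops_union_le`, `hex_newtonVertexCount_union_le`).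

Conventions (spelled inline, no new definitions): `Δ` is ANY self-map of `ℂ[X,Y]` with
`coeff e (Δ p) = (e₀ - e₁) · coeff e p` (the Euler derivation `X∂_X - Y∂_Y`, which kills the diagonal
direction); "x-only" `P` means `∀ e ∈ P.support, e 1 = 0`, "y-only" `∀ e ∈ Q.support, e 0 = 0`, "diagonal"
`∀ e ∈ D.support, e 0 = e 1`; "separated of rank `R`" means `m = Σ_{r<R} P_r · Q_r` with `P_r` x-only and
`Q_r` y-only. [folklore]
-/

set_option linter.dupNamespace false

noncomputable section

namespace Summit.ValiantsHypothesis.ValiantsHypothesis.Theorems.NewtonUnitEquationsNewtonTauWeak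

open scoped BigOperators
open MvPolynomial
open Literature.Computability.AlgebraicComplexity (newtonVertexCount)
open Summit.ValiantsHypothesis.ValiantsHypothesis.Theorems.NewtonTauWeakVdp
open Summit.ValiantsHypothesis.ValiantsHypothesis.Theorems.NewtonTauWeak.Negative (vert)

namespace HexagonPlanar

/-- Two points of the line `a·p₀ + b·p₁ = c` (`(a, b) ≠ 0`) differ by a real multiple of the
direction `(b, -a)`. [folklore] -/
theorem exists_eq_smul_vadd {a b c : ℝ} (hab : a ≠ 0 ∨ b ≠ 0) {x y : Fin 2 → ℝ}
    (hx : a * x 0 + b * x 1 = c) (hy : a * y 0 + b * y 1 = c) :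
    ∃ t : ℝ, y = t • ![b, -a] +ᵥ x := by
  rcases hab with ha | hb
  · refine ⟨(x 1 - y 1) / a, funext fun i => ?_⟩
    rw [vadd_eq_add, Pi.add_apply, Pi.smul_apply, smul_eq_mul]
    fin_cases i
    · simp only [Fin.zero_eta, Fin.isValue, Matrix.cons_val_zero]
      field_simp
      linear_combination hy - hx
    · simp only [Fin.mk_one, Fin.isValue, Matrix.cons_val_one, Matrix.cons_val_fin_one]
      field_simp
      ring
  · refine ⟨(y 0 - x 0) / b, funext fun i => ?_⟩
    rw [vadd_eq_add, Pi.add_apply, Pi.smul_apply, smul_eq_mul]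
    fin_cases i
    · simp only [Fin.zero_eta, Fin.isValue, Matrix.cons_val_zero]
      field_simp
      ring
    · simp only [Fin.mk_one, Fin.isValue, Matrix.cons_val_one, Matrix.cons_val_fin_one]
      field_simp
      linear_combination hy - hx

/-- An extreme point of `A` is not weakly between two points of `A` different from it. [folklore] -/
theorem not_wbtw_of_mem_extremePoints {E : Type*} [AddCommGroup E] [Module ℝ E] {A : Set E}
    {x y z : E} (hx : x ∈ A) (hz : z ∈ A) (hy : y ∈ Set.extremePoints ℝ A) (hxy : x ≠ y)
    (hzy : z ≠ y) (h : Wbtw ℝ x y z) : False :=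
  hxy (hy.2 hx hz (mem_openSegment_of_ne_left_right hxy hzy h.mem_segment))

end HexagonPlanar

/-- At most two extreme points of a planar convex hull lie on a given line. -/
theorem hex_ncard_extremePoints_inter_line_le_two (S : Set (Fin 2 → ℝ)) (a b c : ℝ) (hab : a ≠ 0 ∨ b ≠ 0) :
    (Set.extremePoints ℝ (convexHull ℝ S) ∩ {p | a * p 0 + b * p 1 = c}).ncard ≤ 2 := by
  by_contra h
  rw [not_le] at h
  obtain ⟨x, hx, y, hy, z, hz, hxy, hxz, hyz⟩ :=
    (Set.two_lt_ncard (Set.finite_of_ncard_pos (by omega))).1 h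
  have hline : ∀ p ∈ ({x, y, z} : Set (Fin 2 → ℝ)), a * p 0 + b * p 1 = c := by
    intro p hp
    simp only [Set.mem_insert_iff, Set.mem_singleton_iff] at hp
    rcases hp with rfl | rfl | rfl
    · exact hx.2
    · exact hy.2
    · exact hz.2
  have hcol : Collinear ℝ ({x, y, z} : Set (Fin 2 → ℝ)) :=
    (collinear_iff_of_mem (Set.mem_insert _ _)).2
      ⟨![b, -a], fun p hp => HexagonPlanar.exists_eq_smul_vadd hab hx.2 (hline p hp)⟩
  rcases hcol.wbtw_or_wbtw_or_wbtw with h | h | h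
  · exact HexagonPlanar.not_wbtw_of_mem_extremePoints hx.1.1 hz.1.1 hy.1 hxy (Ne.symm hyz) h
  · exact HexagonPlanar.not_wbtw_of_mem_extremePoints hy.1.1 hx.1.1 hz.1 hyz hxz h
  · exact HexagonPlanar.not_wbtw_of_mem_extremePoints hz.1.1 hy.1.1 hx.1 (Ne.symm hxz) (Ne.symm hxy) h

/-- At most two tops of `f` (over all weights) lie on a line `e₀ - e₁ = r`. -/
theorem hex_ncard_tops_sub_eq_le_two (f : MvPolynomial (Fin 2) ℂ) (r : ℤ) :
    {v : Fin 2 →₀ ℕ | (∃ w : Fin 2 → ℝ, IsTop w f v) ∧ ((v 0 : ℕ) : ℤ) - ((v 1 : ℕ) : ℤ) = r}.ncard ≤ 2 := by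
  have hfin : (Set.extremePoints ℝ (convexHull ℝ
      ((fun e : Fin 2 →₀ ℕ => fun i : Fin 2 => ((e i : ℕ) : ℝ)) '' (f.support : Set (Fin 2 →₀ ℕ)))) ∩
        {p | (1 : ℝ) * p 0 + (-1) * p 1 = (r : ℝ)}).Finite :=
    ((f.support.finite_toSet.image _).subset extremePoints_convexHull_subset).subset
      Set.inter_subset_left
  refine (Set.ncard_le_ncard_of_injOn (fun e : Fin 2 →₀ ℕ => fun i : Fin 2 => ((e i : ℕ) : ℝ)) ?_
    ChartPairCount.emb_injective.injOn hfin).trans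
    (hex_ncard_extremePoints_inter_line_le_two _ 1 (-1) (r : ℝ) (Or.inl one_ne_zero))
  rintro v ⟨⟨w, hw⟩, hv⟩
  refine ⟨ChartPairCount.emb_mem_extremePoints_of_isTop hw, ?_⟩
  have hv' : (((v 0 : ℕ) : ℤ) : ℝ) - (((v 1 : ℕ) : ℤ) : ℝ) = ((r : ℤ) : ℝ) := by
    exact_mod_cast congrArg (Int.cast : ℤ → ℝ) hv
  show (1 : ℝ) * ((v 0 : ℕ) : ℝ) + (-1) * ((v 1 : ℕ) : ℝ) = (r : ℝ)
  push_cast at hv'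
  linear_combination hv'

/-- The indicator polynomial of a finite set of exponents has exactly that support. -/
theorem hex_support_sum_monomial_one (S : Finset (Fin 2 →₀ ℕ)) :
    (∑ e ∈ S, monomial e (1 : ℂ)).support = S := by
  classical
  ext e
  rw [mem_support_iff, coeff_sum]
  simp only [coeff_monomial]
  rw [Finset.sum_ite_eq']
  split_ifs with h
  · exact ⟨fun _ => h, fun _ => one_ne_zero⟩
  · exact ⟨fun h0 => absurd rfl h0, fun he => absurd he h⟩

/-- A top of `U` (support = union) lying in `supp Mᵢ` is a top of `Mᵢ`, and dominates `supp Mᵢ` anyway. -/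
theorem hex_isTop_of_support_eq_union {U M : MvPolynomial (Fin 2) ℂ} {w : Fin 2 → ℝ} {z : Fin 2 →₀ ℕ}
    (hU : M.support ⊆ U.support) (hz : IsTop w U z) :
    (∀ e ∈ M.support, wdeg w e ≤ wdeg w z) ∧ (z ∈ M.support → IsTop w M z) := by
  exact ⟨fun _ he => hz.le (hU he), fun hzM => ⟨hzM, fun _ he' hne => hz.lt (hU he') hne⟩⟩

/-- Chart tops of `U` with `supp U = supp M₀ ∪ supp M₁ ∪ supp M₂` number at most `V(M₀)+V(M₁)+V(M₂)`. -/
theorem hex_ncard_chartTops_union_le (σ : ℝ) (U M₀ M₁ M₂ : MvPolynomial (Fin 2) ℂ)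
    (hU : U.support = M₀.support ∪ M₁.support ∪ M₂.support) :
    {z : Fin 2 →₀ ℕ | ∃ t : ℝ, IsGeneric ![σ, t] ∧ IsTop ![σ, t] U z}.ncard ≤
      newtonVertexCount M₀ + newtonVertexCount M₁ + newtonVertexCount M₂ := by
  have h0 : M₀.support ⊆ U.support := by
    rw [hU]
    exact Finset.subset_union_left.trans Finset.subset_union_left
  have h1 : M₁.support ⊆ U.support := by
    rw [hU]
    exact Finset.subset_union_right.trans Finset.subset_union_left
  have h2 : M₂.support ⊆ U.support := by
    rw [hU]
    exact Finset.subset_union_right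
  have hsub : {z : Fin 2 →₀ ℕ | ∃ t : ℝ, IsGeneric ![σ, t] ∧ IsTop ![σ, t] U z} ⊆
      ({b | ∃ w : Fin 2 → ℝ, IsTop w M₀ b} ∪ {b | ∃ w : Fin 2 → ℝ, IsTop w M₁ b}) ∪
        {b | ∃ w : Fin 2 → ℝ, IsTop w M₂ b} := by
    rintro z ⟨t, -, hz⟩
    have hzU : z ∈ M₀.support ∪ M₁.support ∪ M₂.support := by
      rw [← hU]
      exact hz.mem
    rcases Finset.mem_union.1 hzU with hz01 | hz2
    · rcases Finset.mem_union.1 hz01 with hz0 | hz1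
      · exact Or.inl (Or.inl ⟨_, (hex_isTop_of_support_eq_union h0 hz).2 hz0⟩)
      · exact Or.inl (Or.inr ⟨_, (hex_isTop_of_support_eq_union h1 hz).2 hz1⟩)
    · exact Or.inr ⟨_, (hex_isTop_of_support_eq_union h2 hz).2 hz2⟩
  calc {z : Fin 2 →₀ ℕ | ∃ t : ℝ, IsGeneric ![σ, t] ∧ IsTop ![σ, t] U z}.ncard
      ≤ (({b | ∃ w : Fin 2 → ℝ, IsTop w M₀ b} ∪ {b | ∃ w : Fin 2 → ℝ, IsTop w M₁ b}) ∪
          {b | ∃ w : Fin 2 → ℝ, IsTop w M₂ b}).ncard :=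
        Set.ncard_le_ncard hsub (((ChartPairCount.tops_finite M₀).union
          (ChartPairCount.tops_finite M₁)).union (ChartPairCount.tops_finite M₂))
    _ ≤ ({b | ∃ w : Fin 2 → ℝ, IsTop w M₀ b} ∪ {b | ∃ w : Fin 2 → ℝ, IsTop w M₁ b}).ncard +
          {b | ∃ w : Fin 2 → ℝ, IsTop w M₂ b}.ncard := Set.ncard_union_le _ _
    _ ≤ {b | ∃ w : Fin 2 → ℝ, IsTop w M₀ b}.ncard + {b | ∃ w : Fin 2 → ℝ, IsTop w M₁ b}.ncard +
          {b | ∃ w : Fin 2 → ℝ, IsTop w M₂ b}.ncard :=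
        Nat.add_le_add_right (Set.ncard_union_le _ _) _
    _ ≤ newtonVertexCount M₀ + newtonVertexCount M₁ + newtonVertexCount M₂ :=
        add_le_add (add_le_add (ChartPairCount.ncard_tops_le M₀) (ChartPairCount.ncard_tops_le M₁))
          (ChartPairCount.ncard_tops_le M₂)

/-- `hex_newtonVertexCount_union_le` (see file header). [folklore] -/
theorem hex_newtonVertexCount_union_le (U M₀ M₁ M₂ : MvPolynomial (Fin 2) ℂ)
    (hU : U.support = M₀.support ∪ M₁.support ∪ M₂.support) :
    newtonVertexCount U ≤ 2 * (newtonVertexCount M₀ + newtonVertexCount M₁ + newtonVertexCount M₂) := by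
  have h := stub_vertexCharts U
  have hp := hex_ncard_chartTops_union_le 1 U M₀ M₁ M₂ hU
  have hm := hex_ncard_chartTops_union_le (-1) U M₀ M₁ M₂ hU
  omega


end Summit.ValiantsHypothesis.ValiantsHypothesis.Theorems.NewtonUnitEquationsNewtonTauWeak

end
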